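import Summits.Ventures.HodgeRepro2.T5BergmanGodementRuhlU
import Summits.Ventures.HodgeRepro2.T5BergmanGodementOperator

/-!
# Godement's identity in operator form on `U(1,1)` against Rühl's measure `μ_{U,R}`

The operator form of `T5BergmanGodementOperator` transported to `H = U(1,1)`: `π_k(g) f` is
holomorphic and square-integrable for `g ∈ U(1,1)` (`U(1,1) = Z · SU(1,1)`, the centre acting by
the character `λ^k`: `differentiableOn_actU`, `integrableOn_actU`), a matrix coefficient against a
coherent state is a point evaluation (`matrixCoeffU_kernel`), and
`∫_{U(1,1)} (π_k(g x⁻¹) f)(z) ⟨π_k(x) f', h'⟩_k dμ_{U,R}(x) = ⟨f, h'⟩_k (π_k(g) f')(z) / (k - 1)`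
(`godement_operatorU`); at `g = 1`, `π_k(φ_v)` is `(k-1)⁻¹` times the rank-one operator
`f ↦ ⟨f, v⟩_k v` (`godement_operatorU_rankOne`) — the SAME formal degree `k - 1` on `U(1,1)`
against `μ_{U,R}` as on `SU(1,1)` against `μ_R`. Nothing is claimed about (N).

Blind lane: Mathlib + the HodgeRepro2 prefix only; no sorry; axioms ⊆ {propext, Classical.choice,
Quot.sound}.
-/

namespace Summit.Ventures.HodgeRepro2.T5BergmanGodementOperatorU

open MeasureTheory MeasureTheory.Measure Metric Filter Topology Set
open T5PoincareDensity T5PoincareMeasure T5SU11Unimodular T5U11Unimodular T5U11Product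
  T5SU11Fibration T5SU11FibrationHaar T5HaarCircle T5SU11CoefficientL2
open T5BergmanCoefficient T5BergmanPairing T5BergmanFourier T5BergmanParseval T5BergmanProjection
  T5BergmanActStable T5BergmanMatrixCoeff T5BergmanSchur T5BergmanSchurGeneral T5BergmanU11
  T5BergmanSchurGeneralU11 T5BergmanGodementU11 T5U11RuhlMeasure T5BergmanKernel T5BergmanCoeffL2
  T5BergmanGodementRuhlU T5BergmanGodementOperator
open scoped Real

/-! ### `π_k(g) f` for `g ∈ U(1,1)` is holomorphic and square-integrable -/

/-- `π_k(λ h) f = λ^k · π_k(h) f` as functions (`λ ∈ Z`, `h ∈ SU(1,1)`). -/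
lemma actU_mulHom_eq (k : ℕ) (lam : Circle) (h : SU11) (f : ℂ → ℂ) :
    actU k (mulHom (lam, h)) f = fun z => (lam : ℂ) ^ k * act k h f z :=
  funext (actU_mulHom k lam h f)

/-- **`π_k(g) f` is holomorphic on the disc** for `g ∈ U(1,1)` when `f` is. -/
theorem differentiableOn_actU (k : ℕ) (g : U11) (f : ℂ → ℂ)
    (hf : DifferentiableOn ℂ f (ball 0 1)) : DifferentiableOn ℂ (actU k g f) (ball 0 1) := by
  obtain ⟨⟨lam, h⟩, rfl⟩ := mulHom_surjective g
  rw [actU_mulHom_eq]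
  exact (differentiableOn_act k h f hf).const_mul _

/-- **`π_k(g) f ∈ A_k`** for `g ∈ U(1,1)` when `f ∈ A_k` (`|λ| = 1`). -/
theorem integrableOn_actU (k : ℕ) (hk : 2 ≤ k) (g : U11) (f : ℂ → ℂ)
    (hf : DifferentiableOn ℂ f (ball 0 1))
    (hint : IntegrableOn (fun w => ‖f w‖ ^ 2 * (1 - ‖w‖ ^ 2) ^ (k - 2)) (ball (0 : ℂ) 1)) :
    IntegrableOn (fun w => ‖actU k g f w‖ ^ 2 * (1 - ‖w‖ ^ 2) ^ (k - 2)) (ball (0 : ℂ) 1) := by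
  obtain ⟨⟨lam, h⟩, rfl⟩ := mulHom_surjective g
  rw [actU_mulHom_eq]
  refine (integrableOn_act k hk h f hf hint).congr_fun (fun w _ => ?_) measurableSet_ball
  simp only [norm_mul, norm_pow, Circle.norm_coe, one_pow, one_mul]

/-- **A matrix coefficient of `U(1,1)` against a coherent state is a point evaluation**:
`⟨π_k(g) f, K_z⟩_k = π/(k-1) · (π_k(g) f)(z)`. -/
theorem matrixCoeffU_kernel (k : ℕ) (hk : 2 ≤ k) (f : ℂ → ℂ)
    (hf : DifferentiableOn ℂ f (ball 0 1))
    (hfint : IntegrableOn (fun w => ‖f w‖ ^ 2 * (1 - ‖w‖ ^ 2) ^ (k - 2)) (ball (0 : ℂ) 1))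
    (g : U11) {z : ℂ} (hz : z ∈ ball (0 : ℂ) 1) :
    matrixCoeffU k f (kernel k z) g = ((π / ((k : ℝ) - 1) : ℝ) : ℂ) * actU k g f z :=
  pairing_kernel_of_differentiableOn k hk _ (differentiableOn_actU k g f hf)
    (integrableOn_actU k hk g f hf hfint) hz

/-! ### Godement's identity in operator form on `U(1,1)` -/

variable [MeasurableSpace Circle] [BorelSpace Circle] [MeasurableSpace U11] [BorelSpace U11]

/-- **GODEMENT'S IDENTITY IN OPERATOR FORM ON `U(1,1)`** (against `μ_{U,R}`): for holomorphic
`f, f', h' ∈ A_k` (`k ≥ 2`), `g ∈ U(1,1)` and `z ∈ 𝔻`,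
`∫_{U(1,1)} (π_k(g x⁻¹) f)(z) ⟨π_k(x) f', h'⟩_k dμ_{U,R}(x) = ⟨f, h'⟩_k (π_k(g) f')(z) / (k - 1)`. -/
theorem godement_operatorU (k : ℕ) (hk : 2 ≤ k) (f f' h' : ℂ → ℂ)
    (hf : DifferentiableOn ℂ f (ball 0 1))
    (hfint : IntegrableOn (fun w => ‖f w‖ ^ 2 * (1 - ‖w‖ ^ 2) ^ (k - 2)) (ball (0 : ℂ) 1))
    (hf' : DifferentiableOn ℂ f' (ball 0 1))
    (hf'int : IntegrableOn (fun w => ‖f' w‖ ^ 2 * (1 - ‖w‖ ^ 2) ^ (k - 2)) (ball (0 : ℂ) 1))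
    (hh' : DifferentiableOn ℂ h' (ball 0 1))
    (hh'int : IntegrableOn (fun w => ‖h' w‖ ^ 2 * (1 - ‖w‖ ^ 2) ^ (k - 2)) (ball (0 : ℂ) 1))
    (g : U11) {z : ℂ} (hz : z ∈ ball (0 : ℂ) 1) :
    ∫ x, actU k (g * x⁻¹) f z * matrixCoeffU k f' h' x ∂ruhlU =
      pairing k f h' * actU k g f' z / ((k : ℂ) - 1) := by
  set c : ℂ := ((π / ((k : ℝ) - 1) : ℝ) : ℂ) with hc
  have hc0 : c ≠ 0 := pi_div_ne_zero k hk
  have h := integral_matrixCoeffU_mul_inv_mul_ruhlU k hk f (kernel k z) f' h' hf hfint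
    (differentiableOn_kernel k hz)
    (integrableOn_sq_weight_of_continuousOn k (continuousOn_kernel k hz)) hf' hf'int hh' hh'int g
  have e1 : ∀ x : U11, matrixCoeffU k f (kernel k z) (g * x⁻¹) * matrixCoeffU k f' h' x =
      c * (actU k (g * x⁻¹) f z * matrixCoeffU k f' h' x) := fun x => by
    rw [matrixCoeffU_kernel k hk f hf hfint (g * x⁻¹) hz, ← hc]
    ring
  simp_rw [e1] at h
  rw [integral_const_mul, matrixCoeffU_kernel k hk f' hf' hf'int g hz, ← hc] at h
  apply mul_left_cancel₀ hc0
  rw [h]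
  ring

/-- **The convolution operator `π_k(φ_{f',h'})` on `U(1,1)` at `g = 1`**:
`∫_{U(1,1)} (π_k(x⁻¹) f)(z) ⟨π_k(x) f', h'⟩_k dμ_{U,R}(x) = ⟨f, h'⟩_k f'(z) / (k - 1)`. -/
theorem godement_operatorU_one (k : ℕ) (hk : 2 ≤ k) (f f' h' : ℂ → ℂ)
    (hf : DifferentiableOn ℂ f (ball 0 1))
    (hfint : IntegrableOn (fun w => ‖f w‖ ^ 2 * (1 - ‖w‖ ^ 2) ^ (k - 2)) (ball (0 : ℂ) 1))
    (hf' : DifferentiableOn ℂ f' (ball 0 1))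
    (hf'int : IntegrableOn (fun w => ‖f' w‖ ^ 2 * (1 - ‖w‖ ^ 2) ^ (k - 2)) (ball (0 : ℂ) 1))
    (hh' : DifferentiableOn ℂ h' (ball 0 1))
    (hh'int : IntegrableOn (fun w => ‖h' w‖ ^ 2 * (1 - ‖w‖ ^ 2) ^ (k - 2)) (ball (0 : ℂ) 1))
    {z : ℂ} (hz : z ∈ ball (0 : ℂ) 1) :
    ∫ x, actU k x⁻¹ f z * matrixCoeffU k f' h' x ∂ruhlU =
      pairing k f h' * f' z / ((k : ℂ) - 1) := by
  have h := godement_operatorU k hk f f' h' hf hfint hf' hf'int hh' hh'int 1 hz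
  have e : actU k (1 : U11) f' z = f' z := by
    rw [← map_one incl, actU_incl, act_one]
  simp only [one_mul, e] at h
  exact h

/-- **`π_k(φ_v)` on `U(1,1)` is `(k-1)⁻¹` times the rank-one projector onto `v`.** -/
theorem godement_operatorU_rankOne (k : ℕ) (hk : 2 ≤ k) (f v : ℂ → ℂ)
    (hf : DifferentiableOn ℂ f (ball 0 1))
    (hfint : IntegrableOn (fun w => ‖f w‖ ^ 2 * (1 - ‖w‖ ^ 2) ^ (k - 2)) (ball (0 : ℂ) 1))
    (hv : DifferentiableOn ℂ v (ball 0 1))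
    (hvint : IntegrableOn (fun w => ‖v w‖ ^ 2 * (1 - ‖w‖ ^ 2) ^ (k - 2)) (ball (0 : ℂ) 1))
    {z : ℂ} (hz : z ∈ ball (0 : ℂ) 1) :
    ∫ x, actU k x⁻¹ f z * matrixCoeffU k v v x ∂ruhlU = pairing k f v * v z / ((k : ℂ) - 1) :=
  godement_operatorU_one k hk f v v hf hfint hv hvint hv hvint hz

end Summit.Ventures.HodgeRepro2.T5BergmanGodementOperatorU
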